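import Mathlib
import Literature.NumberTheory.LFunctions.Zhang2022.AppendixBVarrho
import Literature.NumberTheory.LFunctions.HallTenenbaumTheorem01
import HarnessLib

/-!
# Zhang (2022), Appendix B: the mean value of `|ϱ_j|` — `Σ_{n≤x} |ϱ_j(n)| ≪ x/log x` and short windows

Topic `Literature/NumberTheory/LFunctions/Zhang2022` (Landau–Siegel audit tree; verdict-neutral).
Y. Zhang, *Discrete mean estimates and the Landau–Siegel zero*, arXiv:2211.02515v1 (2022)
[Zhang2022LandauSiegel] — **an unrefereed manuscript under adjudication**. Companion of `AppendixBVarrho`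
(`rho v n = Σ_{d∣n} μ(d)d^{iv}`, the source's `ϱ_j` of Appendix B with `β_j = iv`). The proof of (B.3)
(Appendix B p. 108, "By (4.2) and (4.3), the left side of (B.3) is equal to … + O(α₁)", DAG `Z22:§B.u013`)
replaces the sharp cut-off weight `ϰ₁` by the Gaussian-smoothed weight `g`; the replacement is harmless
termwise only because `|ϱ_j|` is SMALL ON AVERAGE (its logarithmic mean `Σ_{n≤x}|ϱ_j(n)|/n` is `O(1)`,
`AppendixBVarrho.sum_norm_rho_div_le`, while `Σ_{n≤x} τ₂(n)/n ≍ log²x`). This file turns the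
logarithmic mean into an ordinary mean by Hall–Tenenbaum's Theorem 01 (the tree's
`HallTenenbaum.theorem01`, Halberstam–Richert):

* `sum_norm_rho_le` — `Σ_{n≤x} |ϱ_v(n)| ≤ K·(x/log x)·e^{|v| log 4x}` for `x ≥ 2`,
  `K = (2 log 4 + 2B₁ + 1)·majorantConst 0 1` (`|ϱ_v(p^ν)| ≤ 2` gives (0.5) with `A = 2 log 4` and
  (0.6) with `B = 2B₁` by comparison with the constant function `1`);
* `sum_norm_rho_div_window_le` — on the window `N/e < l ≤ eN` (`N ≥ e`):
  `Σ |ϱ_v(l)|/l ≤ e²K·e^{|v| log(4eN)}/log N`.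

These feed the `α₁`-estimate of `Z22:§B.u013` (the transition of the weight at `l₁l = P^{1/2}`).
No claim about Lemma 15.1, Theorems 1–2 of the source or about Landau–Siegel zeros is made.
-/

noncomputable section

open Real Finset

namespace Literature.NumberTheory.LFunctions.Zhang2022.AppendixBVarrho

open Literature.NumberTheory.LFunctions Literature.NumberTheory.LFunctions.Zhang2022 MeanSquareMajorant

/-- The constant of the mean-value bound: `K = (2 log 4 + 2B₁ + 1)·majorantConst 0 1`. [folklore] -/
private theorem K_pos : 0 < (2 * Real.log 4 + 2 * HallTenenbaum.B₁ + 1) * majorantConst 0 1 := by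
  have h1 : 0 ≤ Real.log 4 := Real.log_nonneg (by norm_num)
  have h2 := HallTenenbaum.B₁_nonneg
  have h3 := majorantConst_pos 0 1
  positivity

/-- **`Σ_{n≤x} |ϱ_v(n)| ≤ K·(x/log x)·e^{|v| log(4⌊x⌋)}`** for `x ≥ 2` (Hall–Tenenbaum Theorem 01 with
`A = 2 log 4`, `B = 2B₁`, then the logarithmic mean `AppendixBVarrho.sum_norm_rho_div_le`).
[cite: Zhang2022LandauSiegel, App. B p.108 (proof of (B.3))] -/
theorem sum_norm_rho_le (v : ℝ) {x : ℝ} (hx : 2 ≤ x) :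
    ∑ n ∈ Icc 1 ⌊x⌋₊, ‖rho v n‖ ≤
      (2 * Real.log 4 + 2 * HallTenenbaum.B₁ + 1) * majorantConst 0 1 * (x / Real.log x) *
        Real.exp (|v| * Real.log (4 * ⌊x⌋₊)) := by
  set f : ℕ → ℝ := fun n => ‖rho v n‖ with hf
  have hf1 : f 1 = 1 := by simp [hf, rho_one]
  have hmul : ∀ m n, Nat.Coprime m n → f (m * n) = f m * f n := fun m n hmn => by
    simp only [hf, rho_mul_of_coprime v hmn, norm_mul]
  have hf0 : ∀ n, 0 ≤ f n := fun n => norm_nonneg _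
  -- `f(p^ν) ≤ 2`
  have hf2 : ∀ p ν : ℕ, p.Prime → f (p ^ ν) ≤ 2 := by
    intro p ν hp
    rcases Nat.eq_zero_or_pos ν with rfl | hν
    · simp [hf1]
    · exact norm_rho_prime_pow_le_two v hp hν.ne'
  -- (0.5) and (0.6) by comparison with the constant function `1`
  have hone1 : ∀ n : ℕ, (fun _ : ℕ => (1 : ℝ)) n ≤ 1 := fun _ => le_rfl
  have hA : ∀ y : ℝ, 0 ≤ y → ∑ p ∈ Nat.primesLE ⌊y⌋₊, f p * Real.log p ≤ 2 * Real.log 4 * y := by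
    intro y hy
    have h := HallTenenbaum.hypA_of_le_one (f := fun _ : ℕ => (1 : ℝ)) hone1 hy
    calc ∑ p ∈ Nat.primesLE ⌊y⌋₊, f p * Real.log p
        ≤ ∑ p ∈ Nat.primesLE ⌊y⌋₊, 2 * ((1 : ℝ) * Real.log p) := by
          refine sum_le_sum fun p hp => ?_
          have hp' := (Nat.mem_primesLE.1 hp).2
          have := hf2 p 1 hp'
          rw [pow_one] at this
          rw [one_mul]
          exact mul_le_mul_of_nonneg_right this (Real.log_natCast_nonneg p)
      _ = 2 * ∑ p ∈ Nat.primesLE ⌊y⌋₊, (1 : ℝ) * Real.log p := by rw [mul_sum]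
      _ ≤ 2 * (Real.log 4 * y) := by gcongr
      _ = 2 * Real.log 4 * y := by ring
  have hB : ∀ Y : ℕ, ∑ p ∈ Nat.primesLE Y, ∑ ν ∈ Icc 2 Y, f (p ^ ν) / p ^ ν * Real.log (p ^ ν) ≤
      2 * HallTenenbaum.B₁ := by
    intro Y
    have h := HallTenenbaum.hypB_of_le_one (f := fun _ : ℕ => (1 : ℝ)) hone1 Y
    calc ∑ p ∈ Nat.primesLE Y, ∑ ν ∈ Icc 2 Y, f (p ^ ν) / p ^ ν * Real.log (p ^ ν)
        ≤ ∑ p ∈ Nat.primesLE Y, ∑ ν ∈ Icc 2 Y, 2 * ((1 : ℝ) / p ^ ν * Real.log (p ^ ν)) := by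
          refine sum_le_sum fun p hp => sum_le_sum fun ν _ => ?_
          have hp' := (Nat.mem_primesLE.1 hp).2
          have hlog : 0 ≤ Real.log ((p : ℝ) ^ ν) := by
            rw [← Nat.cast_pow]; exact Real.log_natCast_nonneg _
          have hpν : (0 : ℝ) < (p : ℝ) ^ ν := by
            have : (0 : ℝ) < p := by exact_mod_cast hp'.pos
            positivity
          calc f (p ^ ν) / p ^ ν * Real.log (p ^ ν) ≤ 2 / p ^ ν * Real.log (p ^ ν) :=
                mul_le_mul_of_nonneg_right
                  (div_le_div_of_nonneg_right (hf2 p ν hp') hpν.le) hlog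
            _ = 2 * ((1 : ℝ) / p ^ ν * Real.log (p ^ ν)) := by ring
      _ = 2 * ∑ p ∈ Nat.primesLE Y, ∑ ν ∈ Icc 2 Y, (1 : ℝ) / p ^ ν * Real.log (p ^ ν) := by
          rw [mul_sum]; refine sum_congr rfl fun p _ => by rw [mul_sum]
      _ ≤ 2 * HallTenenbaum.B₁ := by gcongr
  have hx1 : 1 < x := by linarith
  have hX2 : 2 ≤ ⌊x⌋₊ := Nat.le_floor (by exact_mod_cast hx)
  have h01 := HallTenenbaum.theorem01 hf1 hmul hf0 hA hB hx1
  have hlog := sum_norm_rho_div_le v hX2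
  have hxlog : 0 ≤ x / Real.log x := div_nonneg (by linarith) (Real.log_nonneg hx1.le)
  have hK0 : 0 ≤ 2 * Real.log 4 + 2 * HallTenenbaum.B₁ + 1 := by
    have h1 : 0 ≤ Real.log 4 := Real.log_nonneg (by norm_num)
    have h2 := HallTenenbaum.B₁_nonneg
    positivity
  calc ∑ n ∈ Icc 1 ⌊x⌋₊, f n
      ≤ (2 * Real.log 4 + 2 * HallTenenbaum.B₁ + 1) * (x / Real.log x) *
          ∑ n ∈ Icc 1 ⌊x⌋₊, f n / n := h01
    _ ≤ (2 * Real.log 4 + 2 * HallTenenbaum.B₁ + 1) * (x / Real.log x) *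
          (majorantConst 0 1 * Real.exp (|v| * Real.log (4 * ⌊x⌋₊))) :=
        mul_le_mul_of_nonneg_left hlog (mul_nonneg hK0 hxlog)
    _ = _ := by ring

/-- **The short window**: for `N ≥ e`,
`Σ_{N/e < l ≤ eN} |ϱ_v(l)|/l ≤ e²K·e^{|v| log(4eN)}/log N` (`K` as in `sum_norm_rho_le`): since
`Σ_{l≤eN}|ϱ_v(l)| ≤ K(eN/log(eN))e^{|v| log(4eN)}` and `1/l < e/N` on the window.
[cite: Zhang2022LandauSiegel, App. B p.108 (proof of (B.3))] -/
theorem sum_norm_rho_div_window_le (v : ℝ) {N : ℝ} (hN : Real.exp 1 ≤ N) :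
    ∑ l ∈ (Icc 1 ⌊Real.exp 1 * N⌋₊).filter (fun l : ℕ => N / Real.exp 1 < l), ‖rho v l‖ / l ≤
      Real.exp 1 ^ 2 * ((2 * Real.log 4 + 2 * HallTenenbaum.B₁ + 1) * majorantConst 0 1) *
        Real.exp (|v| * Real.log (4 * (Real.exp 1 * N))) / Real.log N := by
  set K : ℝ := (2 * Real.log 4 + 2 * HallTenenbaum.B₁ + 1) * majorantConst 0 1 with hK
  have hKpos : 0 < K := K_pos
  have he : (1 : ℝ) < Real.exp 1 := by linarith [Real.add_one_le_exp (1 : ℝ)]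
  have he0 : 0 < Real.exp 1 := Real.exp_pos 1
  have hN0 : 0 < N := lt_of_lt_of_le he0 hN
  have hlogN : 1 ≤ Real.log N := by rw [← Real.log_exp 1]; exact Real.log_le_log he0 hN
  have hx : 2 ≤ Real.exp 1 * N := by nlinarith [Real.add_one_le_exp (1 : ℝ)]
  -- termwise: `1/l ≤ e/N` on the window
  have hwin : ∀ l ∈ (Icc 1 ⌊Real.exp 1 * N⌋₊).filter (fun l : ℕ => N / Real.exp 1 < l),
      ‖rho v l‖ / l ≤ Real.exp 1 / N * ‖rho v l‖ := by
    intro l hl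
    rw [mem_filter] at hl
    have hl0 : (0 : ℝ) < l := lt_trans (div_pos hN0 he0) hl.2
    rw [div_eq_inv_mul]
    refine mul_le_mul_of_nonneg_right ?_ (norm_nonneg _)
    rw [inv_le_comm₀ hl0 (div_pos he0 hN0), inv_div]
    exact hl.2.le
  have hmain := sum_norm_rho_le v hx
  have hfloor : (4 : ℝ) * ⌊Real.exp 1 * N⌋₊ ≤ 4 * (Real.exp 1 * N) := by
    gcongr; exact Nat.floor_le (by positivity)
  have hfloor0 : (0 : ℝ) < 4 * ⌊Real.exp 1 * N⌋₊ := by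
    have : 2 ≤ ⌊Real.exp 1 * N⌋₊ := Nat.le_floor (by exact_mod_cast hx)
    have : (2 : ℝ) ≤ ⌊Real.exp 1 * N⌋₊ := by exact_mod_cast this
    linarith
  have hlog_eN : Real.log N ≤ Real.log (Real.exp 1 * N) := by
    rw [Real.log_mul he0.ne' hN0.ne', Real.log_exp]; linarith
  have hlog_eN0 : 0 < Real.log (Real.exp 1 * N) := by linarith
  calc ∑ l ∈ (Icc 1 ⌊Real.exp 1 * N⌋₊).filter (fun l : ℕ => N / Real.exp 1 < l), ‖rho v l‖ / l
      ≤ ∑ l ∈ (Icc 1 ⌊Real.exp 1 * N⌋₊).filter (fun l : ℕ => N / Real.exp 1 < l),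
          Real.exp 1 / N * ‖rho v l‖ := sum_le_sum hwin
    _ ≤ ∑ l ∈ Icc 1 ⌊Real.exp 1 * N⌋₊, Real.exp 1 / N * ‖rho v l‖ :=
        sum_le_sum_of_subset_of_nonneg (filter_subset _ _) fun l _ _ => by positivity
    _ = Real.exp 1 / N * ∑ l ∈ Icc 1 ⌊Real.exp 1 * N⌋₊, ‖rho v l‖ := by rw [mul_sum]
    _ ≤ Real.exp 1 / N * (K * (Real.exp 1 * N / Real.log (Real.exp 1 * N)) *
          Real.exp (|v| * Real.log (4 * ⌊Real.exp 1 * N⌋₊))) :=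
        mul_le_mul_of_nonneg_left hmain (by positivity)
    _ ≤ Real.exp 1 / N * (K * (Real.exp 1 * N / Real.log N) *
          Real.exp (|v| * Real.log (4 * (Real.exp 1 * N)))) := by
        gcongr
    _ = Real.exp 1 ^ 2 * K * Real.exp (|v| * Real.log (4 * (Real.exp 1 * N))) / Real.log N := by
        field_simp

end Literature.NumberTheory.LFunctions.Zhang2022.AppendixBVarrho
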